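import Literature.Barriers.CriticalPhenomena.GridSAWSquaresShift
import Literature.Barriers.CriticalPhenomena.GridSAWDrawingChecker
import Literature.Barriers.CriticalPhenomena.GridSAWInstanceCanon
import Literature.Computability.Complexity.StackBricksArith
import HarnessLib

/-!
# Barrier `GridSAWCountingSharpPComplete`, squares step, machine part: the shift
# `R₃ = squaresReduceShift` is polynomial time (`encodeNat ∘ squaresReduceShift ∈ FP`)

Sibling of `GridSAWSquaresShift.lean` (the squares step of Liśkiewicz–Ogihara–Toda 2003,
Theorem 7 (4), reduced to the machine fact `LOT2003_thm7_anyLength_squares_FP :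
squaresReduce ∈ FP ∧ encodeNat ∘ squaresReduceShift ∈ FP`, whose two halves
`LOT2003_thm7_anyLength_squares_of` consumes separately; `squaresReduceShift w =
squaresShift N = (N² + 1)(N - 1)` if the decoded presentation `(P, D, s, t)` satisfies
`IsGridDrawing P D ∧ s, t < N = |P|` and `2 ≤ N`, else `1`), `GridSAWInstanceCanon.lean` (the
decoder of presentations is total, `decode_drawnGraph`, and the canonicaliser
`canonDrawnGraphFn ∈ FP` re-encodes: `canonDrawnGraphFn w = encode (decDrawnGraph w)`) and
`GridSAWDrawingChecker.lean` (`drawingChk ∈ FP`, one-bit, `= [1] ↔ IsGridDrawing P D` on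
`drawingArg P D = ⟨code P, code D⟩`). "`R₃ : Σ* → ℕ − {0}` … polynomial-time computable"
[LOT2003, §2.2] is, for the squares step, an assembly of these with the arithmetic bricks of the
tree (`lenBinF`, `ltFn`, `prodFn`, `addFn`, `subFn`, `andFn`, `iteFn`). This file PROVES the
shift half of the machine fact:

* `nBinF` (the binary numeral of `N = |P|` read off a canonical presentation code: the unary
  header of the point-list code, through `lenBinF`), `shiftValidF` (the validity bit
  `drawingChk ⟨code P, code D⟩ ∧ s < N ∧ t < N`), `shiftGeTwoF` (`2 ≤ N`), `shiftMainF`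
  (`⌜(N·N + 1)(N - 1)⌝`), `shiftG` (the case distinction) and
  `squaresShiftFn = shiftG ∘ canonDrawnGraphFn`, all in `FP` (`squaresShiftFn_mem_FP`);
* `shiftG_encode` (its value on `encode (P, D, s, t)`), `squaresShiftFn_eq :
  squaresShiftFn = encodeNat ∘ squaresReduceShift`, **`squaresReduceShift_mem_FP`**, and the
  corollary `LOT2003_thm7_anyLength_squares_of_reduce_FP`: the squares step now rests on the
  single machine statement `squaresReduce ∈ FP` (the generator of the code of `E₃`).

## References

* M. Liśkiewicz, M. Ogihara, S. Toda, *The complexity of counting self-avoiding walks in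
  subgraphs of two-dimensional grids and hypercubes*, TCS 304 (2003) 129–156, §2.2
  (`≤ᵖ_{r-shift}`: "a polynomial-time computable function `R₃`"), §4 (proof of Theorem 7,
  fourth type).
* S. Arora, B. Barak, *Computational Complexity: A Modern Approach*, CUP 2009, §1.3 (closure of
  polynomial time under composition).
-/
noncomputable section

namespace Literature.Barriers.CriticalPhenomena.GridSAW

open _root_.Computability Literature.Computability.Complexity Literature.Computability.Complexity.Brick

/-! ### The bricks -/

/-- The binary numeral of `N = |P|` read off a canonical presentation code
`⟨code P, ⟨code D, ⟨⌜s⌝, ⌜t⌝⟩⟩⟩`: the point-list code is `⟨1^N, items⟩`, so `N` is the length of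
its first field. [folklore] -/
def nBinF : List Bool → List Bool := lenBinF ∘ fstF ∘ nthF 0

/-- The validity bit `IsGridDrawing P D ∧ s < N ∧ t < N` on canonical presentation codes.
[cite: LiskiewiczOgiharaToda2003, §4 (proof of Theorem 7: validity of the presentation)] -/
def shiftValidF : List Bool → List Bool :=
  andFn (drawingChk ∘ fanoutFn (nthF 0) (nthF 1))
    (andFn (ltFn ∘ fanoutFn (nthF 2) nBinF) (ltFn ∘ fanoutFn (sndPow 2) nBinF))

/-- The bit `2 ≤ N` (`1 < N`). [folklore] -/
def shiftGeTwoF : List Bool → List Bool := ltFn ∘ fanoutFn (fun _ => encodeNat 1) nBinF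

/-- The numeral `⌜(N·N + 1)(N - 1)⌝ = ⌜β (N - 1)⌝`. [cite: LiskiewiczOgiharaToda2003, §4 (proof of Theorem 7, fourth type: the shift)] -/
def shiftMainF : List Bool → List Bool :=
  prodFn ∘ fanoutFn (addFn ∘ fanoutFn (prodFn ∘ fanoutFn nBinF nBinF) fun _ => encodeNat 1)
    (subFn ∘ fanoutFn nBinF fun _ => encodeNat 1)

/-- The shift on canonical presentation codes: `⌜β (N - 1)⌝` if valid and `2 ≤ N`, else `⌜1⌝`.
[cite: LiskiewiczOgiharaToda2003, §4 (proof of Theorem 7, fourth type)] -/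
def shiftG : List Bool → List Bool :=
  iteFn (andFn shiftValidF shiftGeTwoF) shiftMainF fun _ => encodeNat 1

/-- **`R₃` as an `FP` brick**: canonicalise, then `shiftG`. [cite: LiskiewiczOgiharaToda2003, §2.2 and §4 (proof of Theorem 7)] -/
def squaresShiftFn : List Bool → List Bool := shiftG ∘ canonDrawnGraphFn

/-- `nBinF ∈ FP`. [cite: AroraBarak2009, §1.3] -/
theorem nBinF_mem_FP : nBinF ∈ FP :=
  comp_mem_FP lenBinF_mem_FP (comp_mem_FP fstF_mem_FP (nthF_mem_FP 0))

/-- `shiftValidF ∈ FP`. [cite: AroraBarak2009, §1.3] -/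
theorem shiftValidF_mem_FP : shiftValidF ∈ FP :=
  andFn_mem_FP (comp_mem_FP drawingChk_mem_FP (fanoutFn_mem_FP (nthF_mem_FP 0) (nthF_mem_FP 1)))
    (andFn_mem_FP (comp_mem_FP ltFn_mem_FP (fanoutFn_mem_FP (nthF_mem_FP 2) nBinF_mem_FP))
      (comp_mem_FP ltFn_mem_FP (fanoutFn_mem_FP (sndPow_mem_FP 2) nBinF_mem_FP)))

/-- `shiftGeTwoF ∈ FP`. [cite: AroraBarak2009, §1.3] -/
theorem shiftGeTwoF_mem_FP : shiftGeTwoF ∈ FP :=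
  comp_mem_FP ltFn_mem_FP (fanoutFn_mem_FP (const_mem_FP _) nBinF_mem_FP)

/-- `shiftMainF ∈ FP`. [cite: AroraBarak2009, §1.3] -/
theorem shiftMainF_mem_FP : shiftMainF ∈ FP :=
  comp_mem_FP prodFn_mem_FP (fanoutFn_mem_FP
    (comp_mem_FP addFn_mem_FP (fanoutFn_mem_FP (comp_mem_FP prodFn_mem_FP
      (fanoutFn_mem_FP nBinF_mem_FP nBinF_mem_FP)) (const_mem_FP _)))
    (comp_mem_FP subFn_mem_FP (fanoutFn_mem_FP nBinF_mem_FP (const_mem_FP _))))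

/-- `shiftG ∈ FP`. [cite: AroraBarak2009, §1.3] -/
theorem shiftG_mem_FP : shiftG ∈ FP :=
  iteFn_mem_FP (andFn_mem_FP shiftValidF_mem_FP shiftGeTwoF_mem_FP) shiftMainF_mem_FP (const_mem_FP _)

/-- **`squaresShiftFn ∈ FP`.** [cite: AroraBarak2009, §1.3] -/
theorem squaresShiftFn_mem_FP : squaresShiftFn ∈ FP :=
  comp_mem_FP shiftG_mem_FP canonDrawnGraphFn_mem_FP

/-! ### Values on canonical codes -/

section Values

variable (P : List GridPoint) (D : List DrawnEdge) (s t : ℕ)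

/-- The code of a presentation, as a record. [folklore] -/
theorem encode_presentation_eq :
    encodingDrawnGraphInstance.encode (P, D, s, t) =
      boolPair (encodingGridPoint.listBool.encode P)
        (boolPair (encodingDrawnEdge.listBool.encode D) (boolPair (encodeNat s) (encodeNat t))) := rfl

/-- `nBinF` reads `⌜N⌝`. [folklore] -/
theorem nBinF_encode : nBinF (encodingDrawnGraphInstance.encode (P, D, s, t)) = encodeNat P.length := by
  have hlen : (unaryEncodeNat P.length).length = P.length := unary_decode_encode_nat P.length
  simp [nBinF, encode_presentation_eq, encode_pointList_eq, hlen]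

/-- The drawing checker as a `decide`. [folklore] -/
theorem drawingChk_drawingArg_eq_decide :
    drawingChk (drawingArg P D) = [decide (IsGridDrawing P D)] := by
  obtain ⟨b, hb⟩ := oneBit_drawingChk (drawingArg P D)
  rw [hb]
  by_cases h : IsGridDrawing P D
  · rw [decide_eq_true h, ← hb]
    exact (drawingChk_drawingArg_eq_true P D).mpr h
  · have hbf : b = false := by
      cases b
      · rfl
      · exact absurd ((drawingChk_drawingArg_eq_true P D).mp hb) h
    rw [hbf, decide_eq_false h]

/-- The validity bit. [folklore] -/
theorem shiftValidF_encode :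
    shiftValidF (encodingDrawnGraphInstance.encode (P, D, s, t)) =
      [decide (IsGridDrawing P D ∧ s < P.length ∧ t < P.length)] := by
  have hN := nBinF_encode P D s t
  have h1 : (drawingChk ∘ fanoutFn (nthF 0) (nthF 1)) (encodingDrawnGraphInstance.encode (P, D, s, t)) =
      [decide (IsGridDrawing P D)] := by
    rw [← drawingChk_drawingArg_eq_decide P D]
    simp [encode_presentation_eq, drawingArg]
  have h2 : (ltFn ∘ fanoutFn (nthF 2) nBinF) (encodingDrawnGraphInstance.encode (P, D, s, t)) =
      [decide (s < P.length)] := by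
    rw [Function.comp_apply, fanoutFn_apply, hN]
    simp [encode_presentation_eq]
  have h3 : (ltFn ∘ fanoutFn (sndPow 2) nBinF) (encodingDrawnGraphInstance.encode (P, D, s, t)) =
      [decide (t < P.length)] := by
    rw [Function.comp_apply, fanoutFn_apply, hN]
    simp [encode_presentation_eq]
  rw [shiftValidF, andFn_apply h1 (andFn_apply h2 h3)]
  by_cases hD : IsGridDrawing P D <;> by_cases hs : s < P.length <;> by_cases ht : t < P.length <;>
    simp [hD, hs, ht]

/-- The bit `2 ≤ N`. [folklore] -/
theorem shiftGeTwoF_encode :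
    shiftGeTwoF (encodingDrawnGraphInstance.encode (P, D, s, t)) = [decide (2 ≤ P.length)] := by
  rw [shiftGeTwoF, Function.comp_apply, fanoutFn_apply, nBinF_encode, ltFn_boolPair]
  simp only [bitsToNat_encodeNat]
  rfl

/-- The main numeral. [folklore] -/
theorem shiftMainF_encode :
    shiftMainF (encodingDrawnGraphInstance.encode (P, D, s, t)) = encodeNat (squaresShift P.length) := by
  simp [shiftMainF, nBinF_encode, squaresShift, squaresBeta]

/-- **The shift brick on canonical codes**: `⌜squaresShift N⌝` for a valid presentation with
`2 ≤ N`, `⌜1⌝` otherwise — the value of `squaresReduceShift`.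
[cite: LiskiewiczOgiharaToda2003, §4 (proof of Theorem 7, fourth type)] -/
theorem shiftG_encode :
    shiftG (encodingDrawnGraphInstance.encode (P, D, s, t)) =
      encodeNat (if (IsGridDrawing P D ∧ s < P.length ∧ t < P.length) ∧ 2 ≤ P.length then
        squaresShift P.length else 1) := by
  unfold shiftG
  rw [iteFn_apply (andFn_apply (shiftValidF_encode P D s t) (shiftGeTwoF_encode P D s t))]
  by_cases hv : IsGridDrawing P D ∧ s < P.length ∧ t < P.length <;> by_cases h2 : 2 ≤ P.length <;>
    simp [hv, h2, shiftMainF_encode]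

end Values

/-! ### The discharge -/

/-- **`squaresShiftFn = encodeNat ∘ squaresReduceShift`** (the decoder of presentations is total
and the canonicaliser re-encodes). [folklore] -/
theorem squaresShiftFn_eq : squaresShiftFn = encodeNat ∘ squaresReduceShift := by
  funext w
  obtain ⟨hdec, hcanon⟩ := decode_drawnGraph w
  rw [Function.comp_apply, squaresReduceShift, hdec, squaresShiftFn, Function.comp_apply, hcanon]
  obtain ⟨P, D, s, t⟩ := decDrawnGraph w
  rw [shiftG_encode P D s t]

/-- **The shift half of the machine fact of the squares step**:
`encodeNat ∘ squaresReduceShift ∈ FP`. [cite: LiskiewiczOgiharaToda2003, §2.2 ("a polynomial-time computable function R₃ : Σ* → ℕ − {0}") and §4 (proof of Theorem 7, fourth type)] -/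
theorem squaresReduceShift_mem_FP : (encodeNat ∘ squaresReduceShift) ∈ FP := by
  rw [← squaresShiftFn_eq]
  exact squaresShiftFn_mem_FP

/-- With the shift half proved, the squares step `LOT2003_thm7_anyLength_squares` rests on the
single machine statement `squaresReduce ∈ FP` (the polynomial-time generator of the code of
`E₃`). [cite: LiskiewiczOgiharaToda2003, Theorem 7 (proof, fourth type)] -/
theorem LOT2003_thm7_anyLength_squares_of_reduce_FP (h : squaresReduce ∈ FP) :
    LOT2003_thm7_anyLength_squares :=
  LOT2003_thm7_anyLength_squares_of h squaresReduceShift_mem_FP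

end Literature.Barriers.CriticalPhenomena.GridSAW
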